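import Mathlib
import Summits.ValiantsHypothesis.ValiantsHypothesis.Theses.ProjectionRigidity

/-!
# Crux `ProjectionRigidity.ProjOptimalUnique` (stmt-ValiantsHypothesis-16001), line `registered` —
registered stub `stub_pdcPerThree`: THE ANCHOR `pdc(per_3) = 7`

**Claim settled** (stub 0 of the lead's skeleton, TRUE): Valiant's projection determinantal
complexity of the `3 × 3` permanent over `ℂ` is exactly `7`:
`detProjectionComplexity (perPoly (Fin 3) ℂ) = 7`, where
`detProjectionComplexity f = sInf {m | IsDetProjection f m}` and `IsDetProjection f m` says that
`f = det A` for an `m × m` matrix `A` whose entries are variables or constants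
(`Literature/Computability/AlgebraicComplexity/DeterminantalComplexity.lean`).

Proof.
* `≤ 7` (`isDetProjection_perPoly_fin_three`): Grenet's `7 × 7` expression of `per_3`
  (Landsberg 2017, (1.2.3); Hüttenhain–Ikenmeyer 2016, eq. (4)) is a PROJECTION of `DET_7` — its
  entries are `0`, `1` and variables.  We reuse the block presentation of the tree's
  `Literature.Computability.Complexity.hasDetRepr_perPoly_fin_three`
  (`OccurrenceObstructionsFresh.lean`, which records only the weaker affine conclusion
  `HasDetRepr (perPoly (Fin 3) k) 7`): `M = [[A, B'], [C', 1₃]]`, `A = [[0, a], [0, 1₃]]`,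
  `B' = [[0], [B]]`, `C' = [c | 0]`, and two Schur complements (`Matrix.det_fromBlocks_one₂₂`)
  give `det M = a B c = per_3`; then `Nat.sInf_le`.
* `≥ 7`: verbatim the base case of the route's deciding theorem `closes`
  (`Theses/ProjectionRigidity.lean`): `dc(per_3) ≥ 7` by Alper–Bogart–Velasco
  (`exists_subspace_of_isAffineDetRepr_perPoly` + `finrank_le_three_of_subperm_two_vanish`, the
  `2 × 2` subpermanents being the first partials of `per_3` by `VonZurGathen.pderiv_perPoly`), and
  `dc ≤ pdc` (`determinantalComplexity_le_detProjectionComplexity_holds`).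

Unconditional (axioms `propext`, `Classical.choice`, `Quot.sound`). References:
[LandsbergGCT2017] (1.2.3); [Grenet2011]; [HuttenhainIkenmeyer2016] eq. (4);
[AlperBogartVelasco2017] Thm. 1.2, Cor. 1.4; [Valiant1979] §2.
-/

-- layout Summits/ValiantsHypothesis/ValiantsHypothesis forces the duplicated namespace component
set_option linter.dupNamespace false

namespace Summit.ValiantsHypothesis.ValiantsHypothesis.Theorems.ProjectionRigidityProjOptimalUnique

open MvPolynomial Matrix Equiv
open Literature.Computability.AlgebraicComplexity

namespace StubPdcPerThree

/-- **`pdc(per_3) ≤ 7`: Grenet's `7 × 7` expression of `per_3` is a projection of `DET_7`.**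
Over any commutative ring `k`, `perPoly (Fin 3) k = det M` for the explicit `7 × 7` matrix
`M = [[A, B'], [C', 1₃]]`, `A = [[0, a], [0, 1₃]]` (`a` the row `(X₀₀, X₁₀, X₂₀)`),
`B' = [[0], [B]]` (`B_{ij} = X_{l1}` for `{i, j, l} = {0, 1, 2}`, zero diagonal), `C' = [c | 0]`
(`c` the column `(X₀₂, X₁₂, X₂₂)`), all of whose entries are `0`, `1` or a variable; two Schur
complements (`Matrix.det_fromBlocks_one₂₂`) give `det M = a B c = ∑_{i ≠ j} X_{i0} X_{l1} X_{j2}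
= per_3`.  Up to transposition and the order of the blocks this is (1.2.3) of Landsberg 2017
("due to B. Grenet") = eq. (4) of Hüttenhain–Ikenmeyer 2016.
-- adapted from `Literature.Computability.Complexity.hasDetRepr_perPoly_fin_three`
-- (`Literature/Computability/Complexity/OccurrenceObstructionsFresh.lean`), same matrix.
[cite: LandsbergGCT2017, (1.2.3)] -/
theorem isDetProjection_perPoly_fin_three {k : Type*} [CommRing k] :
    IsDetProjection (perPoly (Fin 3) k) 7 := by
  classical
  let R := MvPolynomial (Fin 3 × Fin 3) k
  let a : Matrix (Fin 1) (Fin 3) R := of fun _ j => X (j, 0)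
  let B : Matrix (Fin 3) (Fin 3) R := of fun i j => if i = j then 0 else X (-(i + j), 1)
  let c : Matrix (Fin 3) (Fin 1) R := of fun i _ => X (i, 2)
  let M : Matrix ((Fin 1 ⊕ Fin 3) ⊕ Fin 3) ((Fin 1 ⊕ Fin 3) ⊕ Fin 3) R :=
    fromBlocks (fromBlocks 0 a 0 1) (fromRows 0 B) (fromCols c 0) 1
  let e : (Fin 1 ⊕ Fin 3) ⊕ Fin 3 ≃ Fin 7 :=
    (Equiv.sumCongr finSumFinEquiv (Equiv.refl _)).trans finSumFinEquiv
  refine ⟨fun p => reindex e e M p.1 p.2, fun p => ?_, ?_⟩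
  · -- every entry is a variable or one of the constants `0`, `1`
    have h0 : (∃ v, (0 : R) = X v) ∨ ∃ c, (0 : R) = C c := Or.inr ⟨0, (map_zero C).symm⟩
    have h1 : (∃ v, (1 : R) = X v) ∨ ∃ c, (1 : R) = C c := Or.inr ⟨1, (map_one C).symm⟩
    have hX : ∀ q : Fin 3 × Fin 3, (∃ v, (X q : R) = X v) ∨ ∃ c, (X q : R) = C c :=
      fun q => Or.inl ⟨q, rfl⟩
    obtain ⟨i, j⟩ := p
    show (∃ v, reindex e e M i j = X v) ∨ ∃ c, reindex e e M i j = C c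
    rw [reindex_apply, submatrix_apply]
    generalize e.symm i = i'
    generalize e.symm j = j'
    rcases i' with ((i' | i') | i') <;> rcases j' with ((j' | j') | j') <;>
      simp only [M, a, B, c, fromBlocks_apply₁₁, fromBlocks_apply₁₂, fromBlocks_apply₂₁,
        fromBlocks_apply₂₂, fromRows_apply_inl, fromRows_apply_inr, fromCols_apply_inl,
        fromCols_apply_inr, of_apply, Matrix.zero_apply, one_apply, h0, hX] <;>
      split_ifs <;> first | exact h0 | exact h1 | exact hX _
  · -- `per_3 = det M`
    rw [detPoly, AlgHom.map_det, Matrix.mvPolynomialX_mapMatrix_aeval]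
    change perPoly (Fin 3) k = (reindex e e M).det
    rw [det_reindex_self, det_fromBlocks_one₂₂, fromRows_mul_fromCols]
    have h1 : fromBlocks 0 a 0 (1 : Matrix (Fin 3) (Fin 3) R) -
        fromBlocks ((0 : Matrix (Fin 1) (Fin 3) R) * c)
          ((0 : Matrix (Fin 1) (Fin 3) R) * (0 : Matrix (Fin 3) (Fin 3) R))
          (B * c) (B * (0 : Matrix (Fin 3) (Fin 3) R)) =
        fromBlocks 0 a (-(B * c)) 1 := by
      rw [Matrix.zero_mul, Matrix.zero_mul, Matrix.mul_zero, sub_eq_add_neg, fromBlocks_neg,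
        fromBlocks_add]
      simp
    rw [h1, det_fromBlocks_one₂₂, det_unique]
    have e01 : (-((0 : Fin 3) + 1) : Fin 3) = 2 := rfl
    have e02 : (-((0 : Fin 3) + 2) : Fin 3) = 1 := rfl
    have e10 : (-((1 : Fin 3) + 0) : Fin 3) = 2 := rfl
    have e12 : (-((1 : Fin 3) + 2) : Fin 3) = 0 := rfl
    have e20 : (-((2 : Fin 3) + 0) : Fin 3) = 1 := rfl
    have e21 : (-((2 : Fin 3) + 1) : Fin 3) = 0 := rfl
    simp only [Matrix.sub_apply, Matrix.zero_apply, Matrix.mul_neg, Matrix.neg_apply, mul_apply,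
      Fin.sum_univ_three, a, B, c, of_apply, Fin.default_eq_zero, zero_sub]
    rw [perPoly, Matrix.permanent_fin_three_row]
    simp +decide only [Matrix.mvPolynomialX_apply, e01, e02, e10, e12, e20, e21, if_true, if_false]
    ring

end StubPdcPerThree

/-- **Registered stub `stub_pdcPerThree` of crux `ProjOptimalUnique` (stmt-ValiantsHypothesis-16001):
`pdc(per_3) = 7`.**  `≤`: Grenet's `7 × 7` projection
(`StubPdcPerThree.isDetProjection_perPoly_fin_three`) and `Nat.sInf_le`.  `≥`: the base case of
the route's deciding theorem `closes` (`Theses/ProjectionRigidity.lean`) verbatim —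
`dc(per_3) ≥ 7` by Alper–Bogart–Velasco 2017 (every affine determinantal representation of
`per_3` of size `n` yields a linear space `W` of dimension `≥ 10 - n` on which all `2 × 2`
subpermanents vanish, and such a `W` has dimension `≤ 3`) and `dc ≤ pdc`.
[cite: AlperBogartVelasco2017, Cor. 1.4] -/
theorem stub_pdcPerThree :
    Literature.Computability.AlgebraicComplexity.detProjectionComplexity
      (Literature.Computability.AlgebraicComplexity.perPoly (Fin 3) ℂ) = 7 := by
  refine le_antisymm (Nat.sInf_le StubPdcPerThree.isDetProjection_perPoly_fin_three) ?_
  have h2 : (2 : ℂ) ≠ 0 := two_ne_zero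
  obtain ⟨A, hA⟩ :=
    Literature.Computability.AlgebraicComplexity.hasDetRepr_determinantalComplexity_holds
      (Literature.Computability.AlgebraicComplexity.perPoly (Fin 3) ℂ)
  obtain ⟨W, hW, hvan⟩ :=
    Literature.Computability.AlgebraicComplexity.AlperBogartVelasco.exists_subspace_of_isAffineDetRepr_perPoly
      h2 le_rfl hA
  have hfin : Module.finrank ℂ W ≤ 3 := by
    refine Literature.Computability.AlgebraicComplexity.AlperBogartVelasco.finrank_le_three_of_subperm_two_vanish
      W fun x hx r c => ?_
    have key : MvPolynomial.eval x (MvPolynomial.pderiv (r, c)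
        (Literature.Computability.AlgebraicComplexity.perPoly (Fin 3) ℂ)) =
        ((Matrix.of fun i j => x (i, j)).submatrix r.succAbove c.succAbove).permanent := by
      rw [Literature.Computability.AlgebraicComplexity.VonZurGathen.pderiv_perPoly,
        ← MvPolynomial.aeval_eq_eval,
        Literature.Computability.AlgebraicComplexity.VonZurGathen.aeval_subperm_X,
        Matrix.subperm_eq_permanent_of_equiv _ (finSuccAboveEquiv c) (finSuccAboveEquiv r)]
      rfl
    rw [← key]
    exact hvan x hx (r, c)
  have h7 : 2 ^ 3 - 1 ≤ Literature.Computability.AlgebraicComplexity.determinantalComplexity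
      (Literature.Computability.AlgebraicComplexity.perPoly (Fin 3) ℂ) := by
    norm_num at hW ⊢
    omega
  exact h7.trans
    (Literature.Computability.AlgebraicComplexity.determinantalComplexity_le_detProjectionComplexity_holds _)

end Summit.ValiantsHypothesis.ValiantsHypothesis.Theorems.ProjectionRigidityProjOptimalUnique
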